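import Summits.QuantumFields.YangMills.Theorems.BalabanLadderIROnsetBootstrap
import Summits.QuantumFields.YangMills.Theorems.IR.TypFormatRecursion
import HarnessLib

/-!
# Crux `IR` (stmt-QuantumFields-19354), lane B: the DOBRUSHIN–SHLOSMAN BOOTSTRAP OF THE TYPICAL-CLASS FORMAT Uc
# (`TypShellCondUKPc` at window `n`, threshold `ε` ⇒ at window `j(2n+1)`, threshold `(εM)^j + j(2+3ε)Mδ`, SAME mesh, SAME class)

Helper module for item `stmt-QuantumFields-19354` (`--supports`; it closes nothing).  Route-independent: written against the
disprover's tree mirrors `OnsetFormatsUc.TypShellCondUKPc` / `ClauseIAll` / `ClauseIIukp` / `TypLocal` / `IsFrame`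
(`Theorems/IR/Negative/TypShellCondUKPcFalseOfWildWire.lean`, slot Uc :177–:222 verbatim).

THE POINT.  The tree's `AfPincerUc.Bootstrap.univShellCond_bootstrap` (p522910) iterates the UNIVERSAL shell condition:
`UnivShellCond ρ β b n ε → UnivShellCond ρ β b (j(2n+1)) ((ε·shellCount n)^j)`.  The registered∕mirrored typical-class format
`TypShellCondUKPc ρ β b n ε δ` (clause (i) = mixing for exteriors typical off the resampled region, clause (ii) = UKP rarity of
atypical cells under the kernels, clause (iii) = torus anchor) was so far NOT known to bootstrap: the lead's located remark
(LEAD af-pincer g0 census, «DS bootstrap converse: constant does not close») is that uniformising FIRST (WildWire's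
`abs_sub_le_of_typShellCondUKPc`: insensitivity `2ε + 2Mδ`) may leave the Dobrushin–Shlosman threshold.  Running the block
recursion IN THE TYPICAL CURRENCY (`FiniteSizeCriterion.recursion_decay_typical`, `Theorems/IR/TypFormatRecursion.lean`: rare bad
cells threaded through the induction) closes it:

* §1 `frameFS_of_clauseIAll` — clause (i) at every centre is the recursion's finite-size hypothesis with goodness for the cell map
  `frameCell w`, `Good := Typ`; `frameRare_of_clauseIIukp` — clause (ii) (at singletons, arbitrary exterior good on the
  neighbours) is its rarity hypothesis; `clauseIIukp_shift` ∕ `clauseIAll_shift` ∕ `typLocal_shift` — the format is shift-covariant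
  (a shifted mesh-`b` frame is a mesh-`b` frame: the tree's `AfPincerUc.Supplier.isFrame_shiftFrame` ∕ `shiftFrame_mesh`).
* §2 **`clauseIAll_bootstrap`** — for ONE frame and ONE class: `TypLocal ∧ ClauseIAll(n, ε) ∧ ClauseIIukp(δ)`, `0 ≤ ε`,
  `ε·shellCount n ≤ 1`, `0 ≤ δ` ⇒ `ClauseIAll (j(2n+1)) ((ε·shellCount n)^j + j·(2+3ε)·shellCount n·δ)` for the SAME class.
* §3 **`typShellCondUKPc_bootstrap : TypShellCondUKPc ρ β b n ε δ → TypShellCondUKPc ρ β b (j(2n+1)) ((εM)^j + j(2+3ε)Mδ) δ`**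
  (`b ≥ 1`, continuous `ρ`, Hausdorff second-countable `G`; clauses (ii), (iii) and the class unchanged) and the monotonicity
  `typShellCondUKPc_mono`.

HONEST FRAMING: a constant-bootstrap INSIDE one registered∕mirrored FORMAT of one open gap-crux; the format at a β-dependent mesh
(weak-coupling mixing beyond the correlation length, relativised to a typical class) is assumed, never proved; conditional chain
above the crux untouched; not a gap, not Clay.  No `sorry`; axioms ⊆ {propext, Classical.choice, Quot.sound}.
-/

set_option autoImplicit false

noncomputable section

open MeasureTheory Filter Topology
open Literature.MathematicalPhysics
open Literature.MathematicalPhysics.QuantumFieldTheory Literature.MathematicalPhysics.QuantumLattice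
open Literature.Probability.LatticeModels
open Summit.QuantumFields.YangMills.Cruxes.IR.Tempered (cellEdges windowCells regionEdges)
open Summit.QuantumFields.YangMills.Cruxes.IR.ShellTempered (windowCellsPlus)
open Summit.QuantumFields.YangMills.Cruxes.IR.CellTempered.Engine (frameCell frameCell_eq_iff mem_cellEdges_frameCell
  frame_hC1 finite_frameCell regionEdges_union shiftFrame shiftFrame_mesh cellEdges_shiftFrame regionEdges_shiftFrame)
open Summit.QuantumFields.YangMills.Cruxes.IR.OnsetFormats (shellCount)
open Summit.QuantumFields.YangMills.Cruxes.IR.FixedMesh (ClauseI)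
open Summit.QuantumFields.YangMills.Cruxes.IR.OnsetFormatsUc (IsFrame TypLocal ClauseIAll ClauseIIukp ClauseIII TypShellCondUKPc)
open Summit.QuantumFields.YangMills.Theorems.FiniteSizeCriterion (recursion_decay_typical)
open Summit.QuantumFields.YangMills.Cruxes.IR.CruxIdea2g3 (frame_one_of_mesh)
open Summit.QuantumFields.YangMills.Cruxes.IR.AfPincerUc.Calibration (windowCells_subset_windowCellsPlus)
open Summit.QuantumFields.YangMills.Cruxes.IR.AfPincerUc.Bootstrap (recursionCount_eq_shellCount)

namespace Summit.QuantumFields.YangMills.Cruxes.IR.OnsetFormatsUc.TypBootstrap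

variable {G : Type} [Group G] [TopologicalSpace G] [IsTopologicalGroup G] [CompactSpace G]
  [MeasurableSpace G] [BorelSpace G] {N : ℕ} (ρ : G →* Matrix (Fin N) (Fin N) ℂ)

/-! ## §0 Shift covariance of the format's clauses -/

omit [MeasurableSpace G] [BorelSpace G] in
/-- Iterated shifts compose: `shiftFrame (shiftFrame w x) y = shiftFrame w (y + x)`. -/
theorem shiftFrame_shiftFrame (w : Fin 4 → ℤ → ℤ) (x y : Fin 4 → ℤ) :
    shiftFrame (shiftFrame w x) y = shiftFrame w (y + x) := by
  funext i j
  simp only [shiftFrame, Pi.add_apply, add_assoc]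

/-- The region of `F` in the shifted frame is the region of `F + x` in `w`. -/
theorem regionEdges_shiftFrame_eq (w : Fin 4 → ℤ → ℤ) (x : Fin 4 → ℤ) (F : Finset (Fin 4 → ℤ)) :
    regionEdges (shiftFrame w x) F = regionEdges w (F.image fun c => c + x) := by
  classical
  rw [regionEdges_shiftFrame]
  simp only [Summit.QuantumFields.YangMills.Cruxes.IR.Tempered.regionEdges, Finset.image_biUnion]

/-- Every cell of a frame with steps `≥ 1` has a link (the link at its lowest corner, direction `0`); cf.
`AfPincerUc.Port.exists_mem_cellEdges`. -/
theorem exists_frameCell_eq {w : Fin 4 → ℤ → ℤ} (hw1 : ∀ i j, w i j + 1 ≤ w i (j + 1)) (y : Fin 4 → ℤ) :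
    ∃ e : QuantumLattice.ZdEdge 4, frameCell w e = y := by
  refine ⟨(fun i => w i (y i), 0), (frameCell_eq_iff hw1 _ y).2 ?_⟩
  simp only [Summit.QuantumFields.YangMills.Cruxes.IR.Tempered.cellEdges, Finset.mem_product, Finset.mem_univ,
    and_true, Fintype.mem_piFinset, Finset.mem_Ico]
  intro i
  exact ⟨le_rfl, by linarith [hw1 i (y i)]⟩

omit [Group G] [TopologicalSpace G] [IsTopologicalGroup G] [CompactSpace G] [BorelSpace G] in
/-- `TypLocal` is shift-covariant. -/
theorem typLocal_shift {w : Fin 4 → ℤ → ℤ} {Typ : (Fin 4 → ℤ) → Set (LGConfig 4 G)} (hT : TypLocal w Typ)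
    (x : Fin 4 → ℤ) : TypLocal (shiftFrame w x) (fun c => Typ (c + x)) :=
  ⟨fun c => hT.1 (c + x), fun c => by rw [cellEdges_shiftFrame]; exact hT.2 (c + x)⟩

/-- `ClauseIAll` is shift-covariant. -/
theorem clauseIAll_shift {β : ℝ} {w : Fin 4 → ℤ → ℤ} {n : ℕ} {ε : ℝ} {Typ : (Fin 4 → ℤ) → Set (LGConfig 4 G)}
    (hI : ClauseIAll ρ β w n ε Typ) (x : Fin 4 → ℤ) : ClauseIAll ρ β (shiftFrame w x) n ε (fun c => Typ (c + x)) := by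
  intro c₀
  have h := hI (c₀ + x)
  rw [shiftFrame_shiftFrame]
  have e : (fun c => Typ (c + c₀ + x)) = fun c => Typ (c + (c₀ + x)) := funext fun c => by rw [add_assoc]
  rw [e]
  exact h

/-- `ClauseIIukp` is shift-covariant. -/
theorem clauseIIukp_shift {β : ℝ} {w : Fin 4 → ℤ → ℤ} {δ : ℝ} {Typ : (Fin 4 → ℤ) → Set (LGConfig 4 G)}
    (hII : ClauseIIukp ρ β w δ Typ) (x : Fin 4 → ℤ) : ClauseIIukp ρ β (shiftFrame w x) δ (fun c => Typ (c + x)) := by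
  classical
  intro F F' hFF' hF ζ hcond
  have hinj : Function.Injective fun c : Fin 4 → ℤ => c + x := fun a b h => by simpa using h
  have h := hII (F.image fun c => c + x) (F'.image fun c => c + x) (Finset.image_subset_image hFF') (hF.image _) ζ ?_
  · rw [regionEdges_shiftFrame_eq, Finset.card_image_of_injective _ hinj] at *
    have e : {σ : LGConfig 4 G | ∀ c ∈ F, σ ∉ Typ (c + x)} =
        {σ : LGConfig 4 G | ∀ c ∈ F.image (fun c => c + x), σ ∉ Typ c} := by
      ext σ
      simp only [Set.mem_setOf_eq, Finset.mem_image, forall_exists_index, and_imp, forall_apply_eq_imp_iff₂]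
    rw [e]
    exact h
  · intro c hc c' hc'
    obtain ⟨c₁, hc₁, rfl⟩ := Finset.mem_image.1 hc
    have h' := hcond c₁ hc₁ (c' - x) fun i => by
      have := hc' i; simp only [Pi.sub_apply, Pi.add_apply] at this ⊢; rw [show c' i - x i - c₁ i = c' i - (c₁ i + x i) by ring]
      exact this
    rcases h' with h' | h'
    · exact Or.inl (Finset.mem_image.2 ⟨c' - x, h', sub_add_cancel c' x⟩)
    · right; simpa using h'

/-! ## §1 Clause (i) ∕ clause (ii) are the typical recursion's hypotheses on frame cells -/

/-- **`ClauseIAll` ⇒ hypothesis `hFS` of `FiniteSizeCriterion.recursion_decay_typical`** for the cell map `frameCell w` and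
`Good := Typ` (`w` a frame with steps `≥ 1`): the condition at centre `x` is clause (i) of the SHIFTED frame at its centre `0`;
goodness of the exteriors on the non-resampled cells of the radius-`(2n+1)` cube is exactly clause (i)'s typicality on
`windowCellsPlus n ∖ Y`. -/
theorem frameFS_of_clauseIAll {β : ℝ} {n : ℕ} {ε : ℝ} {w : Fin 4 → ℤ → ℤ} (hw1 : ∀ i j, w i j + 1 ≤ w i (j + 1))
    {Typ : (Fin 4 → ℤ) → Set (LGConfig 4 G)} (hI : ClauseIAll ρ β w n ε Typ)
    (x : Fin 4 → ℤ) (Λ₀ : Finset (QuantumLattice.ZdEdge 4))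
    (hunion : ∀ v v', frameCell w v = frameCell w v' → v ∈ Λ₀ → v' ∈ Λ₀)
    (hnear : ∀ v ∈ Λ₀, ∀ i, |frameCell w v i - x i| ≤ 2 * n) (hx : ∀ v, frameCell w v = x → v ∈ Λ₀)
    (η η' : LGConfig 4 G) (hagree : ∀ v, (∀ i, |frameCell w v i - x i| ≤ 2 * n) → η v = η' v)
    (hgood : ∀ c : Fin 4 → ℤ, (∀ i, |c i - x i| ≤ 2 * n + 1) → ∀ v, frameCell w v = c → v ∉ Λ₀ →
      η ∈ Typ c ∧ η' ∈ Typ c)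
    (f : LGConfig 4 G → ℝ) (hfdep : DependsOn f {v | frameCell w v = x}) (hfm : Measurable f)
    (hf01 : ∀ σ, 0 ≤ f σ ∧ f σ ≤ 1) :
    |∫ σ, f σ ∂(ymSpecification ρ β Λ₀ η) - ∫ σ, f σ ∂(ymSpecification ρ β Λ₀ η')| ≤ ε := by
  classical
  have hmem : ∀ (y : Fin 4 → ℤ) (e : QuantumLattice.ZdEdge 4),
      e ∈ cellEdges (shiftFrame w x) y ↔ frameCell w e = y + x := by
    intro y e
    rw [cellEdges_shiftFrame, frameCell_eq_iff hw1]
  set Y : Finset (Fin 4 → ℤ) := Λ₀.image fun v => frameCell w v - x with hY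
  have hYsub : Y ⊆ windowCells n := by
    intro y hy
    obtain ⟨v, hv, rfl⟩ := Finset.mem_image.1 hy
    simp only [Summit.QuantumFields.YangMills.Cruxes.IR.Tempered.windowCells, Fintype.mem_piFinset,
      Finset.mem_Icc, Pi.sub_apply]
    intro i
    have h := abs_le.1 (hnear v hv i)
    exact ⟨h.1, h.2⟩
  have hcx : frameCell w ((fun i => w i (x i)), (0 : Fin 4)) = x := by
    rw [frameCell_eq_iff hw1]
    simp only [Summit.QuantumFields.YangMills.Cruxes.IR.Tempered.cellEdges, Finset.mem_product,
      Finset.mem_univ, and_true, Fintype.mem_piFinset, Finset.mem_Ico]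
    intro i
    exact ⟨le_rfl, by linarith [hw1 i (x i)]⟩
  have h0Y : (0 : Fin 4 → ℤ) ∈ Y :=
    Finset.mem_image.2 ⟨_, hx _ hcx, by rw [hcx, sub_self]⟩
  have hbiU : regionEdges (shiftFrame w x) Y = Λ₀ := by
    ext e
    simp only [Summit.QuantumFields.YangMills.Cruxes.IR.Tempered.regionEdges, Finset.mem_biUnion]
    constructor
    · rintro ⟨y, hy, he⟩
      obtain ⟨v, hv, rfl⟩ := Finset.mem_image.1 hy
      rw [hmem, sub_add_cancel] at he
      exact hunion v e he.symm hv
    · intro he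
      refine ⟨frameCell w e - x, Finset.mem_image.2 ⟨e, he, rfl⟩, ?_⟩
      rw [hmem, sub_add_cancel]
  have htyp : ∀ c ∈ windowCellsPlus n, c ∉ Y → η ∈ Typ (c + x) ∧ η' ∈ Typ (c + x) := by
    intro c hc hcY
    obtain ⟨e, he⟩ := exists_frameCell_eq hw1 (c + x)
    have heΛ₀ : e ∉ Λ₀ := fun heΛ₀ => hcY (Finset.mem_image.2 ⟨e, heΛ₀, by rw [he, add_sub_cancel_right]⟩)
    refine hgood (c + x) (fun i => ?_) e he heΛ₀
    have hci := Finset.mem_Icc.1 (Fintype.mem_piFinset.1 hc i)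
    rw [Pi.add_apply, add_sub_cancel_right, abs_le]
    exact ⟨hci.1, hci.2⟩
  have hpair : ∀ c ∈ windowCellsPlus n, c ∉ Y → c ∈ windowCells n →
      ∀ e ∈ cellEdges (shiftFrame w x) c, η e = η' e := by
    intro c _ _ hcW e he
    rw [hmem] at he
    refine hagree e fun i => ?_
    have hci := Finset.mem_Icc.1 (Fintype.mem_piFinset.1 hcW i)
    rw [he, Pi.add_apply, add_sub_cancel_right, abs_le]
    exact ⟨hci.1, hci.2⟩
  have hcyl : IsCylinder f (cellEdges (shiftFrame w x) 0) := by
    intro σ σ' h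
    refine hfdep fun v hv => h v ?_
    rw [Finset.mem_coe, hmem, zero_add]
    exact hv
  have key := hI x Y hYsub h0Y η η' htyp hpair f hcyl hfm hf01
  rwa [hbiU] at key

/-- **`ClauseIIukp` ⇒ hypothesis `hRare` of `FiniteSizeCriterion.recursion_decay_typical`** (`δ ≥ 0`): a resampled cell `y` of a
cell-union volume is atypical with kernel-probability `≤ δ` as soon as the exterior is typical on the off-volume cells at
sup-distance `≤ 1` from `y` (clause (ii) at the singleton `F = {y}`, `F' =` the cells of the volume). -/
theorem frameRare_of_clauseIIukp {β : ℝ} {δ : ℝ} (hδ : 0 ≤ δ) {w : Fin 4 → ℤ → ℤ} (hw1 : ∀ i j, w i j + 1 ≤ w i (j + 1))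
    {Typ : (Fin 4 → ℤ) → Set (LGConfig 4 G)} (hII : ClauseIIukp ρ β w δ Typ)
    (Λ : Finset (QuantumLattice.ZdEdge 4)) (hΛ : ∀ v v', frameCell w v = frameCell w v' → v ∈ Λ → v' ∈ Λ)
    (y : Fin 4 → ℤ) (hy : ∃ v ∈ Λ, frameCell w v = y) (ζ : LGConfig 4 G)
    (hζ : ∀ c : Fin 4 → ℤ, (∀ i, |c i - y i| ≤ 1) → ∀ v, frameCell w v = c → v ∉ Λ → ζ ∈ Typ c) :
    (ymSpecification ρ β Λ ζ).real {σ | σ ∉ Typ y} ≤ δ := by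
  classical
  set F' : Finset (Fin 4 → ℤ) := Λ.image (frameCell w) with hF'
  have hΛF' : regionEdges w F' = Λ := by
    ext e
    simp only [Summit.QuantumFields.YangMills.Cruxes.IR.Tempered.regionEdges, Finset.mem_biUnion]
    constructor
    · rintro ⟨c, hc, he⟩
      obtain ⟨v, hv, rfl⟩ := Finset.mem_image.1 hc
      exact hΛ v e ((frameCell_eq_iff hw1 e _).2 he).symm hv
    · intro he
      exact ⟨frameCell w e, Finset.mem_image_of_mem _ he, mem_cellEdges_frameCell hw1 e⟩
  obtain ⟨v₀, hv₀, hv₀y⟩ := hy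
  have hyF' : y ∈ F' := Finset.mem_image.2 ⟨v₀, hv₀, hv₀y⟩
  have hcond : ∀ c ∈ ({y} : Finset (Fin 4 → ℤ)), ∀ c' : Fin 4 → ℤ, (∀ i, |c' i - c i| ≤ 1) → c' ∈ F' ∨ ζ ∈ Typ c' := by
    intro c hc c' hc'
    rw [Finset.mem_singleton] at hc
    subst hc
    by_cases h : c' ∈ F'
    · exact Or.inl h
    · right
      -- the cell `c'` has a link, which is off `Λ`
      obtain ⟨e, hec⟩ := exists_frameCell_eq hw1 c'
      exact hζ c' hc' e hec fun heΛ => h (Finset.mem_image.2 ⟨e, heΛ, hec⟩)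
  have h := hII {y} F' (Finset.singleton_subset_iff.2 hyF') (Finset.singleton_nonempty y) ζ hcond
  rw [hΛF', Finset.card_singleton, pow_one] at h
  have e : {σ : LGConfig 4 G | ∀ c ∈ ({y} : Finset (Fin 4 → ℤ)), σ ∉ Typ c} = {σ | σ ∉ Typ y} := by
    ext σ; simp
  rw [e] at h
  exact ENNReal.toReal_le_of_le_ofReal hδ h

/-! ## §2 The bootstrap of clause (i) for one frame and one class -/

variable [SecondCountableTopology G] [T2Space G]

/-- **THE TYPICAL BOOTSTRAP (one frame, one class).**  For continuous `ρ` on a Hausdorff second-countable compact group, a frame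
`w` with steps `≥ 1`, a cell-local class `Typ` with clause (i) at every centre at window `n`, threshold `ε ≥ 0`,
`ε · shellCount n ≤ 1`, and clause (ii) at rarity `δ ≥ 0`: clause (i) holds at every centre at window `j(2n+1)` with threshold
`(ε·shellCount n)^j + j·(2+3ε)·shellCount n·δ`, for the SAME class (the typical block recursion `recursion_decay_typical` on the
cells of the shifted frame, at `Λ = regionEdges _ Y`, an arbitrary cell union, centre `0`). -/
theorem clauseIAll_bootstrap (hρ : Continuous ρ) {β : ℝ} {n : ℕ} {ε δ : ℝ} (hε : 0 ≤ ε) (hεM : ε * shellCount n ≤ 1)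
    (hδ : 0 ≤ δ) {w : Fin 4 → ℤ → ℤ} (hw1 : ∀ i j, w i j + 1 ≤ w i (j + 1)) {Typ : (Fin 4 → ℤ) → Set (LGConfig 4 G)}
    (hT : TypLocal w Typ) (hI : ClauseIAll ρ β w n ε Typ) (hII : ClauseIIukp ρ β w δ Typ) (j : ℕ) :
    ClauseIAll ρ β w (j * (2 * n + 1)) ((ε * shellCount n) ^ j + j * ((2 + 3 * ε) * shellCount n * δ)) Typ := by
  intro c₀ Y hY h0 σ σ' htyp hagree f hf hfm hf01
  -- work in the shifted frame `w' = shiftFrame w c₀` with the shifted class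
  set w' := shiftFrame w c₀ with hw'
  set Typ' : (Fin 4 → ℤ) → Set (LGConfig 4 G) := fun c => Typ (c + c₀) with hTyp'
  have hw1' : ∀ i j, w' i j + 1 ≤ w' i (j + 1) := fun i j => by
    have h := hw1 i (j + c₀ i); simp only [hw', shiftFrame]; rwa [add_right_comm j 1 (c₀ i)]
  have hT' : TypLocal w' Typ' := typLocal_shift hT c₀
  have hI' : ClauseIAll ρ β w' n ε Typ' := clauseIAll_shift ρ hI c₀
  have hII' : ClauseIIukp ρ β w' δ Typ' := clauseIIukp_shift ρ hII c₀
  have hγ := isSpecification_ymSpecification_of_t2Space (d := 4) ρ hρ β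
  have hfdep : DependsOn f {v | frameCell w' v = 0} := fun U V h =>
    hf fun e he => h e ((frameCell_eq_iff hw1' e 0).2 (Finset.mem_coe.1 he))
  have hGooddep : ∀ c, DependsOn (fun σ : LGConfig 4 G => σ ∈ Typ' c) {v | frameCell w' v = c} := fun c U V h =>
    hT'.2 c fun e he => h e ((frameCell_eq_iff hw1' e c).2 (Finset.mem_coe.1 he))
  -- agreement and goodness of the two exteriors in the recursion's form
  have hcellW : ∀ (v : QuantumLattice.ZdEdge 4) (r : ℤ), (∀ i, |frameCell w' v i - (0 : Fin 4 → ℤ) i| ≤ r) →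
      r ≤ 2 * ((j * (2 * n + 1) : ℕ) : ℤ) → frameCell w' v ∈ windowCells (j * (2 * n + 1)) := by
    intro v r hd hr
    simp only [Summit.QuantumFields.YangMills.Cruxes.IR.Tempered.windowCells, Fintype.mem_piFinset, Finset.mem_Icc]
    intro i
    have h := abs_le.1 (hd i)
    simp only [Pi.zero_apply, sub_zero] at h
    constructor <;> linarith [h.1, h.2]
  have hagree' : ∀ v, v ∉ regionEdges w' Y →
      (∀ i, |frameCell w' v i - (0 : Fin 4 → ℤ) i| ≤ j * (2 * n + 1)) → σ v = σ' v := by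
    intro v hv hd
    set c := frameCell w' v with hc
    have hvc : v ∈ cellEdges w' c := mem_cellEdges_frameCell hw1' v
    have hcW : c ∈ windowCells (j * (2 * n + 1)) := hcellW v _ hd (by push_cast; nlinarith)
    have hcY : c ∉ Y := fun hcY => hv (Finset.mem_biUnion.2 ⟨c, hcY, hvc⟩)
    exact hagree c (windowCells_subset_windowCellsPlus _ hcW) hcY hcW v hvc
  have hgood' : ∀ c : Fin 4 → ℤ, (∀ i, |c i - (0 : Fin 4 → ℤ) i| ≤ j * (2 * n + 1) + 1) →
      ∀ v, frameCell w' v = c → v ∉ regionEdges w' Y → σ ∈ Typ' c ∧ σ' ∈ Typ' c := by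
    intro c hc v hvc hv
    have hcP : c ∈ windowCellsPlus (j * (2 * n + 1)) := by
      simp only [Summit.QuantumFields.YangMills.Cruxes.IR.ShellTempered.windowCellsPlus, Fintype.mem_piFinset,
        Finset.mem_Icc]
      intro i
      have h := abs_le.1 (hc i)
      simp only [Pi.zero_apply, sub_zero] at h
      push_cast
      constructor <;> nlinarith [h.1, h.2]
    have hcY : c ∉ Y := fun hcY => hv (Finset.mem_biUnion.2 ⟨c, hcY, (frameCell_eq_iff hw1' v c).1 hvc⟩)
    exact htyp c hcP hcY
  have h := recursion_decay_typical (d := 4) hγ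
    (fun Λ g T hg hT => dependsOn_integral_ymSpecification ρ hρ β Λ hg hT)
    (cell := frameCell w') (frame_hC1 hw1') (finite_frameCell hw1') (Good := Typ') hT'.1 hGooddep hε
    (by rwa [recursionCount_eq_shellCount])
    (frameFS_of_clauseIAll ρ hw1' hI') hδ (frameRare_of_clauseIIukp ρ hδ hw1' hII') j (regionEdges w' Y)
    (regionEdges_union hw1' Y) 0 f hfm hf01 hfdep σ σ' hagree' hgood'
  rwa [recursionCount_eq_shellCount] at h

/-! ## §3 The bootstrap of the format, and monotonicity -/

omit [SecondCountableTopology G] [T2Space G] in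
/-- `TypShellCondUKPc` is monotone in the threshold and the rarity (`0 ≤ δ ≤ δ'`, `ε ≤ ε'`). -/
theorem typShellCondUKPc_mono {β : ℝ} {b n : ℕ} {ε ε' δ δ' : ℝ} (hεε' : ε ≤ ε') (hδ : 0 ≤ δ) (hδδ' : δ ≤ δ')
    (h : TypShellCondUKPc ρ β b n ε δ) : TypShellCondUKPc ρ β b n ε' δ' := by
  intro w hw
  obtain ⟨Typ, hT, hI, hII, hIII⟩ := h w hw
  have hpow : ∀ k : ℕ, ENNReal.ofReal (δ ^ k) ≤ ENNReal.ofReal (δ' ^ k) := fun k =>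
    ENNReal.ofReal_le_ofReal (pow_le_pow_left₀ hδ hδδ' k)
  refine ⟨Typ, hT, fun c₀ Y hY h0 σ σ' htyp hagree f hf hfm hf01 =>
    (hI c₀ Y hY h0 σ σ' htyp hagree f hf hfm hf01).trans hεε', fun F F' hFF' hF ζ hc => (hII F F' hFF' hF ζ hc).trans (hpow _),
    fun S hS F hF hin => (hIII S hS F hF hin).trans (hpow _)⟩

/-- **THE BOOTSTRAP OF FORMAT Uc.**  For continuous `ρ` on a Hausdorff second-countable compact group, `b ≥ 1`, `0 ≤ ε`,
`ε · shellCount n ≤ 1`, `0 ≤ δ`: `TypShellCondUKPc ρ β b n ε δ → TypShellCondUKPc ρ β b (j·(2n+1)) ((ε·shellCount n)^j +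
j·(2+3ε)·shellCount n·δ) δ` for every `j` — SAME mesh, SAME class per frame, clauses (ii)∕(iii) verbatim; clause (i) at the larger
window by `clauseIAll_bootstrap`.  The Typ twin of `AfPincerUc.Bootstrap.univShellCond_bootstrap`. -/
theorem typShellCondUKPc_bootstrap (hρ : Continuous ρ) {β : ℝ} {b n : ℕ} (hb : 1 ≤ b) {ε δ : ℝ} (hε : 0 ≤ ε)
    (hεM : ε * shellCount n ≤ 1) (hδ : 0 ≤ δ) (h : TypShellCondUKPc ρ β b n ε δ) (j : ℕ) :
    TypShellCondUKPc ρ β b (j * (2 * n + 1)) ((ε * shellCount n) ^ j + j * ((2 + 3 * ε) * shellCount n * δ)) δ := by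
  intro w hw
  obtain ⟨Typ, hT, hI, hII, hIII⟩ := h w hw
  exact ⟨Typ, hT, clauseIAll_bootstrap ρ hρ hε hεM hδ (frame_one_of_mesh hb hw) hT hI hII j, hII, hIII⟩

end Summit.QuantumFields.YangMills.Cruxes.IR.OnsetFormatsUc.TypBootstrap

end
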